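import Mathlib
import Literature.Analysis.FluidPDE.TaoCascadeODE
import HarnessLib

/-!
# `HeteroclinicTriggerChain` — crux `TriggerChainFrontStep` (item stmt-NavierStokesRegularity-22785):
  window utilities for composing the phase lemmas of the lattice hop

The phase lemmas of line `gapdata_v2` (`…LatticeDelay`, `…LatticeCapture`, `…LatticeSeed`,
`…LatticeWake`, `…JunkEnvelope`) are all stated for an exact lattice flow on a window `[0,T]` starting
at time `0`. Composing them along one hop (delay on `[0,T_ign]`, capture from `T_ign`, …) needs two
pieces of plumbing, supplied here:

* `htcFW_shift_exact_flow` — TIME SHIFT: if `S` solves the exact equations of a table pair on `[0,T]`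
  (derivatives within the segment), then `s ↦ S(t₀ + s)` solves them on `[0, T − t₀]` for `0 ≤ t₀ ≤ T`
  (the nonlinearity only reads the family at the current time);
* `htcFW_first_hitting_time` — FIRST HITTING TIME: a function continuous on `[0,T]` with `u(0) < h ≤ u(T)`
  has a first time `τ ∈ (0,T]` with `u(τ) = h` and `u < h` on `[0,τ)` (the ignition time).

HONEST FRAMING: calculus plumbing; helper for the crux (no stub credit); nothing here is a statement about
the Navier–Stokes equations; no summit, rung or crux is proved.
-/

noncomputable section

set_option linter.dupNamespace false

open Real Set

namespace Summit.NavierStokesRegularity.NavierStokesRegularity.Theorems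

open Literature.Analysis.FluidPDE Literature.Analysis.FluidPDE.TaoCascade

/-- The cascade nonlinearity of a time-shifted family is the time-shifted nonlinearity. [folklore] -/
theorem htcFW_quadTerm_shift (ε₀ : ℝ) {m : ℕ} (α : Fin m → Fin m → Fin m → ℤ × ℤ × ℤ → ℝ)
    (S : Fin m → ℤ → ℝ → ℝ) (t₀ : ℝ) (i : Fin m) (n : ℤ) (s : ℝ) :
    quadTerm ε₀ α (fun j k r => S j k (t₀ + r)) i n s = quadTerm ε₀ α S i n (t₀ + s) := by
  unfold quadTerm
  rfl

/-- **Time shift of an exact lattice flow.** If `S_{i,k}′ = quadTerm 1 α₀ S i k + β·quadTerm 1 σ S i k`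
on `[0,T]` (within the segment) and `0 ≤ t₀`, then the shifted family `s ↦ S(t₀ + s)` solves the
same equations on `[0, T − t₀]`. [folklore] -/
theorem htcFW_shift_exact_flow {m : ℕ} (α₀ σ : Fin m → Fin m → Fin m → ℤ × ℤ × ℤ → ℝ) (β : ℝ)
    (S : Fin m → ℤ → ℝ → ℝ) {T t₀ : ℝ} (ht₀ : 0 ≤ t₀)
    (hS : ∀ i k, ∀ t ∈ Icc 0 T, HasDerivWithinAt (S i k)
      (quadTerm 1 α₀ S i k t + β * quadTerm 1 σ S i k t) (Icc 0 T) t) :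
    ∀ i k, ∀ s ∈ Icc 0 (T - t₀), HasDerivWithinAt (fun r => S i k (t₀ + r))
      (quadTerm 1 α₀ (fun j k r => S j k (t₀ + r)) i k s +
        β * quadTerm 1 σ (fun j k r => S j k (t₀ + r)) i k s) (Icc 0 (T - t₀)) s := by
  intro i k s hs
  rw [htcFW_quadTerm_shift, htcFW_quadTerm_shift]
  have hmem : t₀ + s ∈ Icc 0 T := ⟨by linarith [hs.1], by linarith [hs.2]⟩
  have hmaps : MapsTo (fun r : ℝ => t₀ + r) (Icc 0 (T - t₀)) (Icc 0 T) := fun r hr =>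
    ⟨by linarith [hr.1], by linarith [hr.2]⟩
  have hshift : HasDerivWithinAt (fun r : ℝ => t₀ + r) 1 (Icc 0 (T - t₀)) s :=
    ((hasDerivAt_id s).const_add t₀).hasDerivWithinAt
  have h := (hS i k (t₀ + s) hmem).comp s hshift hmaps
  rw [mul_one] at h
  exact h

/-- **First hitting time.** If `u` is continuous on `[0,T]`, `u(0) < h` and `h ≤ u(T)`, there is a first
time `τ ∈ (0,T]` with `u(τ) = h` and `u(t) < h` for `t ∈ [0,τ)`. [folklore] -/
theorem htcFW_first_hitting_time {u : ℝ → ℝ} {T h : ℝ} (hT : 0 ≤ T) (hu : ContinuousOn u (Icc 0 T))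
    (h0 : u 0 < h) (hTh : h ≤ u T) :
    ∃ τ ∈ Ioc 0 T, u τ = h ∧ ∀ t ∈ Ico 0 τ, u t < h := by
  -- the closed set of times where u ≥ h
  set A : Set ℝ := {t ∈ Icc 0 T | h ≤ u t} with hA
  have hAne : A.Nonempty := ⟨T, ⟨right_mem_Icc.2 hT, hTh⟩⟩
  have hAbdd : BddBelow A := ⟨0, fun t ht => ht.1.1⟩
  have hAclosed : IsClosed A := by
    have : A = Icc 0 T ∩ u ⁻¹' (Ici h) := rfl
    rw [this]
    exact hu.preimage_isClosed_of_isClosed isClosed_Icc isClosed_Ici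
  set τ := sInf A with hτ
  have hτA : τ ∈ A := hAclosed.csInf_mem hAne hAbdd
  have hτle : ∀ t ∈ A, τ ≤ t := fun t ht => csInf_le hAbdd ht
  obtain ⟨⟨hτ0, hτT⟩, hτh⟩ := hτA
  -- u < h before τ
  have hbefore : ∀ t ∈ Ico 0 τ, u t < h := by
    intro t ht
    by_contra hcon
    push Not at hcon
    have htA : t ∈ A := ⟨⟨ht.1, ht.2.le.trans hτT⟩, hcon⟩
    exact absurd (hτle t htA) (not_le.2 ht.2)
  -- τ > 0 since u 0 < h
  have hτpos : 0 < τ := by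
    rcases lt_or_eq_of_le hτ0 with h | h
    · exact h
    · exfalso; rw [← h] at hτh; linarith
  -- u τ = h: ≥ by membership, ≤ by continuity from the left
  have hle : u τ ≤ h := by
    -- approach τ from the left inside [0, τ)
    have hcont : ContinuousWithinAt u (Icc 0 T) τ := hu τ ⟨hτ0, hτT⟩
    have hmem : ∀ᶠ t in nhdsWithin τ (Ico 0 τ), u t < h :=
      eventually_nhdsWithin_of_forall fun t ht => hbefore t ht
    have hsub : Ico 0 τ ⊆ Icc 0 T := fun t ht => ⟨ht.1, ht.2.le.trans hτT⟩
    have hcont' : Filter.Tendsto u (nhdsWithin τ (Ico 0 τ)) (nhds (u τ)) :=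
      hcont.mono_left (nhdsWithin_mono _ hsub)
    -- the left filter is nontrivial since τ > 0
    haveI : (nhdsWithin τ (Ico 0 τ)).NeBot := by
      rw [← mem_closure_iff_nhdsWithin_neBot, closure_Ico hτpos.ne, ]
      exact ⟨hτ0, le_rfl⟩
    exact le_of_tendsto hcont' (hmem.mono fun t ht => ht.le)
  exact ⟨τ, ⟨hτpos, hτT⟩, le_antisymm hle hτh, hbefore⟩

end Summit.NavierStokesRegularity.NavierStokesRegularity.Theorems

end
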